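import Literature.Analysis.FluidPDE.MikadoShearPotentialBounds
import Literature.Analysis.FluidPDE.NashCoefficientFields
import Literature.Analysis.FluidPDE.SymmetrizedGradientTensor
import Literature.Analysis.FunctionSpaces.TorusLiftDerivBounds
import HarnessLib

/-!
# One step of the Coiculescu–Palasek data iteration (Def. 3.5) and its estimates
# (Lemma 3.6, the upper bounds of Prop. 3.7, (abounds)/(psidatabounds) of all orders)

Analysis/FluidPDE support file (definitions with proved API; no named facts) on the discharge path of
the principal-parts hypothesis `hA` of
`Literature.Barriers.NavierStokesRegularity.CriticalDataSmoothNonuniqueness_of_principalParts_of_perturbationLe`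
(M. P. Coiculescu, S. Palasek, *Non-uniqueness of smooth solutions of the Navier–Stokes equations from
critical data*, Invent. Math. 244 (2025), arXiv:2503.14699). **Def. 3.5** (transported to the unit
torus `(ℝ/ℤ)³`, where the heat rate of `sin(2πN η·x)` is `4π²N²|η|²`): given the previous potential
`ψ⁰_{k-1}`, the step produces

  `ψ⁰_k = φ_{ℓ_k} ∗ ∑_j a_{j,k} Ψ⁰_{j,k}`,
  `a_{j,k}(x) = N_k (D_{k-1}/(2π² c₀ |η_j|² A_{j,k}))^{1/2} χ_k(x) Γ_j(Id + c₀ 𝒟ψ⁰_{k-1}(x)/D_{k-1})`,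

with the Mikado potentials `Ψ⁰_{j,k}` of Def. 3.1 (`CP25.mikadoPotential`), the Nash coefficients
`Γ_j` (`CP25.nashField`), a cut-off `χ_k`, the phase averages `A_{j,k}` of Lemma 3.2 (4) and a
normalisation `D_{k-1} ≥ ‖𝒟ψ⁰_{k-1}‖_∞` (the paper normalises by `‖𝒟ψ⁰_{k-1}‖_∞` itself; Rmk. 3.12
and every estimate only use that ONE number `D_{k-1}` bounds the tensor and appears in both places,
see `NashCoefficientFields`). This file formalises the step as a map of its data — the profiles
`φ_j`, unit phases `Λ_j`, the previous tensor `T = 𝒟ψ⁰_{k-1}` with its normalisation `D`, the cut-off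
`χ`, the averages `A_j`, the scales `M ∣ N` and the mollification length `ℓ` — and proves:

* `CP25.ampCoeff` (`a_{j,k}`), `CP25.pipePotential` (`Ψ⁰_{j,k}` at the paper's frequencies
  `k = N η_j`), `CP25.stepPre` (`g_k = ∑_j a_{j,k}Ψ⁰_{j,k}`), `CP25.stepPotential` (`ψ⁰_k = k_ℓ ⋆ g_k`),
  `CP25.stepTensor` (`k_ℓ ⋆ 𝒟g_k = 𝒟ψ⁰_k`, `CP25.stepTensor_eq_dTensor_stepPotential`);
* **the tensor identity of Rmk. 3.12** (`CP25.sum_ampCoeff_sq_mul`): pointwise,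
  `∑_j 2π²|η_j|² A_j N⁻² a_j(x)² θ_{ja}θ_{jb} = (D/c₀) χ(x)² δ_{ab} + χ(x)² T_{ab}(x)` — the computation
  "`v̄_k(0,x) = … = ℙ div(χ_{k+1} 𝒟ψ⁰_k)`" before the Leray projection (Nash's identity, Lemma 6.1);
* **all-orders bounds, uniform in the level** (Lemma 3.6, Prop. 3.7 (psidatabounds), Prop. 3.13
  (abounds)), in the currency `Torus.HasLiftDerivBounds n f C L` ("`‖Dⁱf‖_∞ ≤ C Lⁱ`, `i ≤ n`"):
  if the profiles obey `‖Dⁱφ_j‖ ≤ G`, `|φ_j| ≤ 1`, the phases `‖Λ_j‖ ≤ 1`, the previous tensor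
  `‖T‖ ≤ D` with `‖DⁱT‖ ≤ (D/c₀)Λfⁱ`, the cut-off `|χ| ≤ 1` with `‖Dⁱχ‖ ≤ Λfⁱ`, the averages
  `A_j ≥ A₀ > 0`, and `M ≤ N`, then
  - `a_{j}`: amplitude `N √(D) K` and frequency `2Λf` (`CP25.hasLiftDerivBounds_ampCoeff`; the bound
    `‖∇ᵐa_{j,k}‖ ≲_m N_k ‖𝒟ψ_{k-1}‖^{1/2} (M_{k-1} + ‖∇𝒟ψ_{k-1}‖/‖𝒟ψ_{k-1}‖)ᵐ` of Lemma 3.6 / (abounds));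
  - `g_k`, `ψ⁰_k`: amplitude `𝔎 √D N⁻¹`, frequency `2Λf + 20N` (`CP25.hasLiftDerivBounds_stepPre`,
    `CP25.hasLiftDerivBounds_stepPotential`: (iterativeboundsI) `‖ψ⁰_k‖_∞ ≤ C₁N_k⁻¹‖𝒟ψ⁰_{k-1}‖^{1/2}`
    and (psidatabounds) `‖∇ᵐψ⁰_k‖_∞ ≲_m N_k^{-1+m}` when `Λf ≲ N`);
  - `𝒟g_k`, `𝒟ψ⁰_k`: amplitude `8𝔎√D N⁻¹(2Λf+20N)`, i.e. `≲ √D` when `Λf ≲ N` — the UPPER bound of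
    Prop. 3.7, `‖𝒟ψ⁰_k‖_∞ ≤ C (‖𝒟ψ⁰_{k-1}‖_∞)^{1/2}` (`CP25.hasLiftDerivBounds_dTensor_stepPre`);
  - `k_ℓ ⋆ 𝒟g_k` obeys bounds of ALL orders with frequency `c̄_n/ℓ` from its sup norm alone
    (`CP25.hasLiftDerivBounds_stepTensor_of_norm_le`: "placing derivatives on the mollifier",
    proof of Prop. 3.7) — this is what makes the constants independent of the level `k`: the next
    amplitude `a_{j,k+1}` only sees `‖𝒟g_k‖_∞`.
  The lower bound of Prop. 3.7 is not needed for Thm. 1.2 beyond level `0` (distinctness, §5, uses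
  the explicit level-`0` block) and is not formalised.

## Mathlib / tree search

Tree: `CP25.mikadoPotential`, `CP25.norm_iteratedFDeriv_lift_mikadoPotential_le_pow`, `CP25.dirVec`,
`absSum` (`MikadoShearPotential(Bounds)`), `CP25.nashField`, `CP25.sum_nashField_sq_mul`,
`CP25.exists_forall_norm_iteratedFDeriv_lift_nashField_le` (`NashCoefficientFields`), `CP25.dTensor`
(`SymmetrizedGradientTensor`), `Torus.HasLiftDerivBounds` and its algebra (`TorusLiftDerivBounds`),
`Torus.partialDeriv_convolution`, `Torus.clm_comp_convolution` (`TorusConvolution`,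
`TorusMollifierDerivBounds`). `lean search 'ampCoeff|stepPre|a_{j,k}'`: nothing prior.

## References

* M. P. Coiculescu, S. Palasek, Invent. Math. 244 (2025) 165–219, doi:10.1007/s00222-025-01396-z,
  arXiv:2503.14699: Def. 3.1, Lemma 3.2 (1), (4), Def. 3.4, Def. 3.5, Lemma 3.6, Prop. 3.7, Rmk. 3.12,
  Prop. 3.13 ((abounds)), Lemma 6.1. [CoiculescuPalasek2025]
-/

noncomputable section

open Set Function MeasureTheory Filter UnitAddTorus
open scoped BigOperators ContDiff Convolution Topology

namespace Literature.Analysis.FluidPDE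

namespace CP25

open Literature.Analysis.FunctionSpaces Literature.Analysis.FunctionSpaces.Torus
open Literature.MathematicalPhysics.QuantumLattice

/-! ## The objects of one step -/

/-- `|η|² = ∑ᵢ ηᵢ²` of an integer vector, as a real number (the factor `|η_j|²` of Def. 3.5 / Def. 3.10).
[cite: CoiculescuPalasek2025, Def. 3.5] -/
def normSqInt (η : Fin 3 → ℤ) : ℝ := ∑ i, ((η i : ℝ)) ^ 2

/-- **The scalar prefactor of the amplitude**: `N (D/(2π² c₀ |η_j|² A))^{1/2}` (Def. 3.5, unit-torus
normalisation: the paper's `N_k (2‖𝒟ψ‖/(c₀|η_j|²A_{j,k}))^{1/2}` on `(ℝ/2πℤ)³` becomes this after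
`x ↦ 2πx`, the heat rate of the phase being `4π²N²|η_j|²`). [cite: CoiculescuPalasek2025, Def. 3.5] -/
def ampScale (j : Fin 6) (D A : ℝ) (N : ℕ) : ℝ :=
  N * Real.sqrt (D / (2 * Real.pi ^ 2 * nashRadius * normSqInt (nashNormal j) * A))

/-- **The amplitude `a_{j,k}`** of Def. 3.5 as a function of the step data:
`a_j(x) = N (D/(2π²c₀|η_j|²A))^{1/2} χ(x) Γ_j(Id + (c₀/D) T(x))`. [cite: CoiculescuPalasek2025, Def. 3.5] -/
def ampCoeff (j : Fin 6) (T : UnitAddTorus (Fin 3) → (Fin 3 → Fin 3 → ℝ)) (D : ℝ)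
    (χ : UnitAddTorus (Fin 3) → ℝ) (A : ℝ) (N : ℕ) (x : UnitAddTorus (Fin 3)) : ℝ :=
  ampScale j D A N * (χ x * nashField j T D x)

/-- **The Mikado potential `Ψ⁰_{j,k}` at the paper's frequencies**: direction `θ_j`, phase frequency
`N η_j`, profile `φ` rescaled by `M`, unit phase `Λ` (Def. 3.1; `CP25.mikadoPotential`).
[cite: CoiculescuPalasek2025, Def. 3.1] -/
def pipePotential (j : Fin 6) (φ : UnitAddTorus (Fin 3) → ℝ) (Λ : ℂ) (M N : ℕ) :
    UnitAddTorus (Fin 3) → EuclideanSpace ℝ (Fin 3) :=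
  mikadoPotential (nashDir j) ((N : ℤ) • nashNormal j) Λ φ M N

/-- **The pre-mollified potential of the step**: `g_k = ∑_j a_{j,k} Ψ⁰_{j,k}` (Def. 3.5, inside `φ_k ∗`).
[cite: CoiculescuPalasek2025, Def. 3.5] -/
def stepPre (φ : Fin 6 → UnitAddTorus (Fin 3) → ℝ) (Λ : Fin 6 → ℂ)
    (T : UnitAddTorus (Fin 3) → (Fin 3 → Fin 3 → ℝ)) (D : ℝ) (χ : UnitAddTorus (Fin 3) → ℝ)
    (A : Fin 6 → ℝ) (M N : ℕ) (x : UnitAddTorus (Fin 3)) : EuclideanSpace ℝ (Fin 3) :=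
  ∑ j, ampCoeff j T D χ (A j) N x • pipePotential j (φ j) (Λ j) M N x

/-- **The new potential `ψ⁰_k = φ_{ℓ} ∗ g_k`** (Def. 3.5), mollified by the torus kernel `k_ℓ`.
[cite: CoiculescuPalasek2025, Def. 3.5] -/
def stepPotential (φ : Fin 6 → UnitAddTorus (Fin 3) → ℝ) (Λ : Fin 6 → ℂ)
    (T : UnitAddTorus (Fin 3) → (Fin 3 → Fin 3 → ℝ)) (D : ℝ) (χ : UnitAddTorus (Fin 3) → ℝ)
    (A : Fin 6 → ℝ) (M N : ℕ) (ℓ : ℝ) : UnitAddTorus (Fin 3) → EuclideanSpace ℝ (Fin 3) :=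
  kernel ℓ ⋆ stepPre φ Λ T D χ A M N

/-- **The new tensor `k_ℓ ⋆ 𝒟g_k`** (equal to `𝒟ψ⁰_k`, `CP25.stepTensor_eq_dTensor_stepPotential`; kept
in this form so that all its derivatives may be placed on the mollifier).
[cite: CoiculescuPalasek2025, Def. 3.5 and Prop. 3.7 (proof)] -/
def stepTensor (φ : Fin 6 → UnitAddTorus (Fin 3) → ℝ) (Λ : Fin 6 → ℂ)
    (T : UnitAddTorus (Fin 3) → (Fin 3 → Fin 3 → ℝ)) (D : ℝ) (χ : UnitAddTorus (Fin 3) → ℝ)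
    (A : Fin 6 → ℝ) (M N : ℕ) (ℓ : ℝ) : UnitAddTorus (Fin 3) → (Fin 3 → Fin 3 → ℝ) :=
  kernel ℓ ⋆ dTensor (stepPre φ Λ T D χ A M N)

/-! ## Arithmetic of the fixed vectors -/

/-- `|η_j|² ≥ 1`. [cite: CoiculescuPalasek2025, §3.1] -/
theorem one_le_normSqInt_nashNormal (j : Fin 6) : 1 ≤ normSqInt (nashNormal j) := by
  fin_cases j <;> simp [normSqInt, nashNormal, Fin.sum_univ_three]

/-- `0 < |η_j|²`. [cite: CoiculescuPalasek2025, §3.1] -/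
theorem normSqInt_nashNormal_pos (j : Fin 6) : 0 < normSqInt (nashNormal j) :=
  lt_of_lt_of_le one_pos (one_le_normSqInt_nashNormal j)

/-- `|η_j|₁ ≤ 3`. [cite: CoiculescuPalasek2025, §3.1] -/
theorem absSum_nashNormal_le (j : Fin 6) : absSum (nashNormal j) ≤ 3 := by
  fin_cases j <;> simp [absSum, nashNormal, Fin.sum_univ_three] <;> norm_num

/-- `1 + 2π|η_j|₁ ≤ 20`. [folklore] -/
theorem one_add_two_pi_absSum_le (j : Fin 6) : 1 + 2 * Real.pi * absSum (nashNormal j) ≤ 20 := by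
  have h := absSum_nashNormal_le j
  have hπ := Real.pi_lt_d2  -- `π < 3.15`
  nlinarith [absSum_nonneg (nashNormal j), Real.pi_pos]

/-- `‖θ_j‖ ≤ 3` (`θ_j ∈ {(0,0,1),(±2,0,1),(±1,1,1),(0,-2,1)}`, lengths `≤ √5`). [cite: CoiculescuPalasek2025, Lemma 6.1] -/
theorem norm_dirVec_nashDir_le (j : Fin 6) : ‖dirVec (nashDir j)‖ ≤ 3 := by
  rw [EuclideanSpace.norm_eq]
  have h : ∑ i, ‖dirVec (nashDir j) i‖ ^ 2 ≤ 9 := by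
    fin_cases j <;> simp [dirVec, nashDir, Fin.sum_univ_three] <;> norm_num
  calc Real.sqrt (∑ i, ‖dirVec (nashDir j) i‖ ^ 2) ≤ Real.sqrt 9 := Real.sqrt_le_sqrt h
    _ = 3 := by rw [show (9 : ℝ) = 3 ^ 2 by norm_num, Real.sqrt_sq (by norm_num)]

/-! ## The amplitude prefactor -/

section Scale

variable {D A A₀ : ℝ} {N : ℕ}

/-- `0 ≤ ampScale`. [folklore] -/
theorem ampScale_nonneg (j : Fin 6) (D A : ℝ) (N : ℕ) : 0 ≤ ampScale j D A N :=
  mul_nonneg (Nat.cast_nonneg N) (Real.sqrt_nonneg _)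

/-- **The key algebraic identity of the prefactor**: `2π²|η_j|² A N⁻² (ampScale)² = D/c₀`
(for `A, D ≥ 0`, `N > 0`). [cite: CoiculescuPalasek2025, Def. 3.5 with Rmk. 3.12] -/
theorem ampScale_sq_identity (j : Fin 6) (hD : 0 ≤ D) (hA : 0 < A) (hN : 0 < N) :
    2 * Real.pi ^ 2 * normSqInt (nashNormal j) * A * ((N : ℝ) ^ 2)⁻¹ * ampScale j D A N ^ 2 =
      D / nashRadius := by
  have hη := normSqInt_nashNormal_pos j
  have hc := nashRadius_pos
  have hπ : 0 < Real.pi ^ 2 := by positivity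
  have hN' : (0 : ℝ) < N := by exact_mod_cast hN
  have hq : 0 ≤ D / (2 * Real.pi ^ 2 * nashRadius * normSqInt (nashNormal j) * A) := by positivity
  rw [ampScale, mul_pow, Real.sq_sqrt hq]
  field_simp

/-- **Size of the prefactor**: `ampScale ≤ N √D / √(2π²c₀A₀)` when `A ≥ A₀ > 0`, `D ≥ 0`
(`|η_j|² ≥ 1`); written as `ampScale ≤ N √D (2π²c₀A₀)^{-1/2}`. [cite: CoiculescuPalasek2025, Lemma 3.6 (preliminaryabound)] -/
theorem ampScale_le (j : Fin 6) (hD : 0 ≤ D) (hA₀ : 0 < A₀) (hA : A₀ ≤ A) (N : ℕ) :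
    ampScale j D A N ≤ N * (Real.sqrt D * Real.sqrt (2 * Real.pi ^ 2 * nashRadius * A₀)⁻¹) := by
  have hη := one_le_normSqInt_nashNormal j
  have hc := nashRadius_pos
  have hπ : 0 < Real.pi ^ 2 := by positivity
  have hB₀ : 0 < 2 * Real.pi ^ 2 * nashRadius * A₀ := by positivity
  have hB : 2 * Real.pi ^ 2 * nashRadius * A₀ ≤ 2 * Real.pi ^ 2 * nashRadius * normSqInt (nashNormal j) * A := by
    have h1 : 2 * Real.pi ^ 2 * nashRadius * A₀ ≤ 2 * Real.pi ^ 2 * nashRadius * A := by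
      gcongr
    calc 2 * Real.pi ^ 2 * nashRadius * A₀ ≤ 2 * Real.pi ^ 2 * nashRadius * 1 * A := by linarith
      _ ≤ 2 * Real.pi ^ 2 * nashRadius * normSqInt (nashNormal j) * A := by
          gcongr
          linarith [hA]
  unfold ampScale
  refine mul_le_mul_of_nonneg_left ?_ (Nat.cast_nonneg N)
  -- `√(D/B) ≤ √(D/B₀) = √D/√B₀`
  calc Real.sqrt (D / (2 * Real.pi ^ 2 * nashRadius * normSqInt (nashNormal j) * A))
      ≤ Real.sqrt (D / (2 * Real.pi ^ 2 * nashRadius * A₀)) :=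
        Real.sqrt_le_sqrt (div_le_div_of_nonneg_left hD hB₀ hB)
    _ = Real.sqrt D * Real.sqrt (2 * Real.pi ^ 2 * nashRadius * A₀)⁻¹ := by
        rw [Real.sqrt_div' D hB₀.le, div_eq_mul_inv, Real.sqrt_inv]

end Scale

/-! ## The tensor identity of Rmk. 3.12 -/

section Identity

variable {T : UnitAddTorus (Fin 3) → (Fin 3 → Fin 3 → ℝ)} {D : ℝ} {χ : UnitAddTorus (Fin 3) → ℝ}
  {A : Fin 6 → ℝ} {N : ℕ}

/-- **The tensor identity of Rmk. 3.12** (Nash's Lemma 6.1 along the field): at every point `x`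
with `‖T(x)‖ ≤ D` (`D > 0`), `T(x)` symmetric, `A_j > 0`, `N > 0`,
`∑_j 2π²|η_j|² A_j N⁻² a_j(x)² θ_{ja} θ_{jb} = (D/c₀) χ(x)² δ_{ab} + χ(x)² T_{ab}(x)`.
This is the computation `½N_{k+1}⁻² ∑_j A_{j,k+1}|η_j|² a²_{j,k+1} θ_j⊗θ_j = c₀⁻¹‖𝒟ψ⁰_k‖ χ²_{k+1}(Id + c₀𝒟ψ⁰_k/‖𝒟ψ⁰_k‖)`
of Rmk. 3.12 (before `ℙ div`, which kills the multiple of `Id`). [cite: CoiculescuPalasek2025, Rmk. 3.12 and Lemma 6.1] -/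
theorem sum_ampCoeff_sq_mul (hD : 0 < D) {x : UnitAddTorus (Fin 3)} (hT : ‖T x‖ ≤ D)
    (hTs : ∀ a b, T x a b = T x b a) (hA : ∀ j, 0 < A j) (hN : 0 < N) (a b : Fin 3) :
    ∑ j, 2 * Real.pi ^ 2 * normSqInt (nashNormal j) * A j * ((N : ℝ) ^ 2)⁻¹ *
        ampCoeff j T D χ (A j) N x ^ 2 * ((nashDir j a : ℝ) * (nashDir j b : ℝ)) =
      D / nashRadius * χ x ^ 2 * (if a = b then 1 else 0) + χ x ^ 2 * T x a b := by
  have hid := sum_nashField_sq_mul hD hT hTs a b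
  have hterm : ∀ j, 2 * Real.pi ^ 2 * normSqInt (nashNormal j) * A j * ((N : ℝ) ^ 2)⁻¹ *
      ampCoeff j T D χ (A j) N x ^ 2 * ((nashDir j a : ℝ) * (nashDir j b : ℝ)) =
      D / nashRadius * χ x ^ 2 * (nashField j T D x ^ 2 * ((nashDir j a : ℝ) * (nashDir j b : ℝ))) := by
    intro j
    have h := ampScale_sq_identity j hD.le (hA j) hN
    rw [ampCoeff, mul_pow, mul_pow]
    calc 2 * Real.pi ^ 2 * normSqInt (nashNormal j) * A j * ((N : ℝ) ^ 2)⁻¹ *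
          (ampScale j D (A j) N ^ 2 * (χ x ^ 2 * nashField j T D x ^ 2)) * ((nashDir j a : ℝ) * (nashDir j b)) =
        (2 * Real.pi ^ 2 * normSqInt (nashNormal j) * A j * ((N : ℝ) ^ 2)⁻¹ * ampScale j D (A j) N ^ 2) *
          χ x ^ 2 * (nashField j T D x ^ 2 * ((nashDir j a : ℝ) * (nashDir j b))) := by ring
      _ = _ := by rw [h]
  simp_rw [hterm]
  rw [← Finset.mul_sum, hid]
  have hc : nashRadius ≠ 0 := nashRadius_pos.ne'
  have hD' : D ≠ 0 := hD.ne'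
  field_simp

end Identity

/-! ## Uniform constants -/

/-- A common constant `C_Γ(j,n) ≥ 1` bounding the derivatives of orders `≤ n` of all coefficient fields
`Γ_j(Id + (c₀/D)T)` in terms of the bounds on `T` (from `CP25.exists_forall_norm_iteratedFDeriv_lift_nashField_le`,
Lemma 6.1 (GammaboundII)): for each order the least such constant exists by choice; we take a running
maximum so that one number serves all `i ≤ n`. [cite: CoiculescuPalasek2025, Lemma 6.1 (GammaboundII)] -/
def nashFieldConst (j : Fin 6) : ℕ → ℝ
  | 0 => max 1 (Classical.choose (exists_forall_norm_iteratedFDeriv_lift_nashField_le j 0))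
  | n + 1 => max (nashFieldConst j n)
      (Classical.choose (exists_forall_norm_iteratedFDeriv_lift_nashField_le j (n + 1)))

/-- `1 ≤ C_Γ(j,n)`. [folklore] -/
theorem one_le_nashFieldConst (j : Fin 6) (n : ℕ) : 1 ≤ nashFieldConst j n := by
  induction n with
  | zero => exact le_max_left _ _
  | succ n ih => exact ih.trans (le_max_left _ _)

/-- `C_Γ(j,·)` is monotone. [folklore] -/
theorem nashFieldConst_mono (j : Fin 6) {i n : ℕ} (h : i ≤ n) : nashFieldConst j i ≤ nashFieldConst j n := by
  induction n with
  | zero => rw [Nat.le_zero.1 h]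
  | succ n ih =>
    rcases Nat.lt_or_ge i (n + 1) with hlt | hge
    · exact (ih (Nat.lt_succ_iff.1 hlt)).trans (le_max_left _ _)
    · rw [le_antisymm h hge]

/-- The defining property of `C_Γ(j,n)` at the top order. [cite: CoiculescuPalasek2025, Lemma 6.1 (GammaboundII)] -/
theorem norm_iteratedFDeriv_lift_nashField_le_nashFieldConst (j : Fin 6) (n : ℕ)
    {T : UnitAddTorus (Fin 3) → (Fin 3 → Fin 3 → ℝ)} {D Λf : ℝ} (hT : IsSmooth T) (hD : 0 < D)
    (hTb : ∀ x, ‖T x‖ ≤ D) (hΛ : 0 ≤ Λf)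
    (hTn : ∀ i, 1 ≤ i → i ≤ n → ∀ y, ‖iteratedFDeriv ℝ i (lift T) y‖ ≤ D / nashRadius * Λf ^ i)
    (y : EuclideanSpace ℝ (Fin 3)) :
    ‖iteratedFDeriv ℝ n (lift (nashField j T D)) y‖ ≤ nashFieldConst j n * Λf ^ n := by
  have hspec := Classical.choose_spec (exists_forall_norm_iteratedFDeriv_lift_nashField_le j n)
  have h := hspec.2 T D Λf hT hD hTb hΛ hTn y
  refine h.trans (mul_le_mul_of_nonneg_right ?_ (pow_nonneg hΛ n))
  cases n with
  | zero => exact le_max_right _ _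
  | succ n => exact le_max_right _ _

/-- **The coefficient field in the `HasLiftDerivBounds` currency**: from `‖T‖ ≤ D` and
`HasLiftDerivBounds n T (D/c₀) Λf`, `HasLiftDerivBounds n (Γ_j(Id + (c₀/D)T)) C_Γ(j,n) Λf`.
[cite: CoiculescuPalasek2025, Lemma 6.1 (GammaboundII), Lemma 3.6 (proof)] -/
theorem hasLiftDerivBounds_nashField (j : Fin 6) {n : ℕ}
    {T : UnitAddTorus (Fin 3) → (Fin 3 → Fin 3 → ℝ)} {D Λf : ℝ} (hD : 0 < D) (hTb : ∀ x, ‖T x‖ ≤ D)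
    (hT : HasLiftDerivBounds n T (D / nashRadius) Λf) (hΛ : 0 ≤ Λf) :
    HasLiftDerivBounds n (nashField j T D) (nashFieldConst j n) Λf := by
  refine ⟨isSmooth_nashField j hT.isSmooth hD hTb, fun i hi y => ?_⟩
  have h := norm_iteratedFDeriv_lift_nashField_le_nashFieldConst j i hT.isSmooth hD hTb hΛ
    (fun m _ hmi y => hT.bound (hmi.trans hi) y) y
  exact h.trans (mul_le_mul_of_nonneg_right (nashFieldConst_mono j hi) (pow_nonneg hΛ i))

/-! ## Bounds on the amplitude, the pipe potentials and the step -/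

section Bounds

variable {n : ℕ} {φ : Fin 6 → UnitAddTorus (Fin 3) → ℝ} {Λc : Fin 6 → ℂ}
  {T : UnitAddTorus (Fin 3) → (Fin 3 → Fin 3 → ℝ)} {D Λf G A₀ : ℝ} {χ : UnitAddTorus (Fin 3) → ℝ}
  {A : Fin 6 → ℝ} {M N : ℕ} {ℓ : ℝ}

/-- **Bounds on the amplitude `a_j`** (Lemma 3.6 (preliminaryabound)/(gradapreliminarybound) and
(abounds), all orders): with `‖T‖ ≤ D`, `HasLiftDerivBounds n T (D/c₀) Λf`, `|χ| ≤ 1`,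
`HasLiftDerivBounds n χ 1 Λf`, `A ≥ A₀ > 0`:
`HasLiftDerivBounds n a_j (N √D (2π²c₀A₀)^{-1/2} C_Γ(j,n)) (2Λf)`.
[cite: CoiculescuPalasek2025, Lemma 3.6 (proof) and Prop. 3.13 (abounds)] -/
theorem hasLiftDerivBounds_ampCoeff (j : Fin 6) (hD : 0 < D) (hTb : ∀ x, ‖T x‖ ≤ D)
    (hT : HasLiftDerivBounds n T (D / nashRadius) Λf) (hχ : HasLiftDerivBounds n χ 1 Λf) (hΛ : 0 ≤ Λf)
    (hA₀ : 0 < A₀) {A' : ℝ} (hA : A₀ ≤ A') :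
    HasLiftDerivBounds n (ampCoeff j T D χ A' N)
      (N * (Real.sqrt D * Real.sqrt (2 * Real.pi ^ 2 * nashRadius * A₀)⁻¹) * nashFieldConst j n) (2 * Λf) := by
  have hΓ := hasLiftDerivBounds_nashField j hD hTb hT hΛ
  have hprod := hχ.mul hΓ
  rw [one_mul, ← two_mul] at hprod
  have h := hprod.const_mul (ampScale j D A' N)
  rw [abs_of_nonneg (ampScale_nonneg j D A' N)] at h
  refine h.mono ?_ (by positivity) le_rfl
  exact mul_le_mul_of_nonneg_right (ampScale_le j hD.le hA₀ hA N)
    ((one_le_nashFieldConst j n).trans' zero_le_one |> fun _ => le_trans zero_le_one (one_le_nashFieldConst j n))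

/-- **Bounds on the pipe potential `Ψ⁰_j`** (Lemma 3.2 (1), all orders, in the step's currency): with a
profile obeying `HasLiftDerivBounds n φ G 1`, a phase `‖Λ‖ ≤ 1` and `M ≤ N`:
`HasLiftDerivBounds n Ψ⁰_j (3 G N⁻²) (20 N)` (`‖θ_j‖ ≤ 3`, `1 + 2π|η_j|₁ ≤ 20`).
[cite: CoiculescuPalasek2025, Lemma 3.2 (1) (mikadoprofilebound)] -/
theorem hasLiftDerivBounds_pipePotential (j : Fin 6) {φ₁ : UnitAddTorus (Fin 3) → ℝ} {Λ₁ : ℂ}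
    (hφ : HasLiftDerivBounds n φ₁ G 1) (hΛ₁ : ‖Λ₁‖ ≤ 1) (hMN : M ≤ N) :
    HasLiftDerivBounds n (pipePotential j φ₁ Λ₁ M N) (3 * G * ((N : ℝ) ^ 2)⁻¹) (20 * N) := by
  have hG0 : 0 ≤ G := hφ.nonneg
  refine ⟨isSmooth_mikadoPotential _ _ _ hφ.isSmooth _ _, fun m hm y => ?_⟩
  have hGi : ∀ i ≤ m, ∀ z, ‖iteratedFDeriv ℝ i (lift φ₁) z‖ ≤ G := fun i hi z => by
    simpa using hφ.bound (hi.trans hm) z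
  have h := norm_iteratedFDeriv_lift_mikadoPotential_le_pow (nashDir j) (nashNormal j) Λ₁ hφ.isSmooth
    (G := fun _ => G) hGi hMN y
  refine h.trans ?_
  -- the binomial sum `∑_i (m choose i) G (2π|η|₁)^{m-i} = G (1 + 2π|η|₁)^m ≤ G 20^m`
  have hsum : ∑ i ∈ Finset.range (m + 1), (m.choose i : ℝ) * G * (2 * Real.pi * absSum (nashNormal j)) ^ (m - i) =
      G * (1 + 2 * Real.pi * absSum (nashNormal j)) ^ m := by
    rw [add_pow, Finset.mul_sum]
    exact Finset.sum_congr rfl fun i _ => by rw [one_pow]; ring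
  rw [hsum]
  have h20 := one_add_two_pi_absSum_le j
  have hq : 0 ≤ 1 + 2 * Real.pi * absSum (nashNormal j) := by
    have := absSum_nonneg (nashNormal j); positivity
  have hθ := norm_dirVec_nashDir_le j
  calc ((N : ℝ) ^ 2)⁻¹ * (N : ℝ) ^ m * (‖dirVec (nashDir j)‖ * ‖Λ₁‖ * (G * (1 + 2 * Real.pi * absSum (nashNormal j)) ^ m))
      ≤ ((N : ℝ) ^ 2)⁻¹ * (N : ℝ) ^ m * (3 * 1 * (G * (20 : ℝ) ^ m)) := by
        gcongr
    _ = 3 * G * ((N : ℝ) ^ 2)⁻¹ * (20 * (N : ℝ)) ^ m := by rw [mul_pow]; ring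

/-- **Bounds on the pre-mollified potential `g_k = ∑_j a_j Ψ⁰_j`** (Lemma 3.6 and (psidatabounds), all
orders): amplitude `𝔎 √D N⁻¹` with `𝔎 = 3G(2π²c₀A₀)^{-1/2} ∑_j C_Γ(j,n)`, frequency `2Λf + 20N`.
[cite: CoiculescuPalasek2025, Lemma 3.6 (iterativeboundsI), Prop. 3.7 (psidatabounds)] -/
theorem hasLiftDerivBounds_stepPre (hD : 0 < D) (hTb : ∀ x, ‖T x‖ ≤ D)
    (hT : HasLiftDerivBounds n T (D / nashRadius) Λf) (hχ : HasLiftDerivBounds n χ 1 Λf) (hΛ : 0 ≤ Λf)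
    (hφ : ∀ j, HasLiftDerivBounds n (φ j) G 1) (hΛc : ∀ j, ‖Λc j‖ ≤ 1) (hA₀ : 0 < A₀) (hA : ∀ j, A₀ ≤ A j)
    (hMN : M ≤ N) (hN : 0 < N) :
    HasLiftDerivBounds n (stepPre φ Λc T D χ A M N)
      ((3 * G * Real.sqrt (2 * Real.pi ^ 2 * nashRadius * A₀)⁻¹ * ∑ j, nashFieldConst j n) *
        Real.sqrt D * (N : ℝ)⁻¹) (2 * Λf + 20 * N) := by
  have hN' : (0 : ℝ) < N := by exact_mod_cast hN
  have hterm : ∀ j ∈ (Finset.univ : Finset (Fin 6)),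
      HasLiftDerivBounds n (fun x => ampCoeff j T D χ (A j) N x • pipePotential j (φ j) (Λc j) M N x)
        (N * (Real.sqrt D * Real.sqrt (2 * Real.pi ^ 2 * nashRadius * A₀)⁻¹) * nashFieldConst j n *
          (3 * G * ((N : ℝ) ^ 2)⁻¹)) (2 * Λf + 20 * N) := by
    intro j _
    exact (hasLiftDerivBounds_ampCoeff j hD hTb hT hχ hΛ hA₀ (hA j)).smul
      (hasLiftDerivBounds_pipePotential j (hφ j) (hΛc j) hMN)
  have hs := HasLiftDerivBounds.sum Finset.univ hterm (by positivity)
  refine ⟨hs.isSmooth, fun i hi y => (hs.bound hi y).trans (le_of_eq ?_)⟩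
  congr 1
  rw [Finset.mul_sum, Finset.sum_mul, Finset.sum_mul]
  refine Finset.sum_congr rfl fun j _ => ?_
  field_simp

/-- **Bounds on the new potential `ψ⁰_k = k_ℓ ⋆ g_k`**: the same as for `g_k` (the mollifier does not
increase any `‖Dⁱ·‖_∞`). [cite: CoiculescuPalasek2025, Lemma 3.6, Prop. 3.7 (psidatabounds)] -/
theorem hasLiftDerivBounds_stepPotential (hD : 0 < D) (hTb : ∀ x, ‖T x‖ ≤ D)
    (hT : HasLiftDerivBounds n T (D / nashRadius) Λf) (hχ : HasLiftDerivBounds n χ 1 Λf) (hΛ : 0 ≤ Λf)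
    (hφ : ∀ j, HasLiftDerivBounds n (φ j) G 1) (hΛc : ∀ j, ‖Λc j‖ ≤ 1) (hA₀ : 0 < A₀) (hA : ∀ j, A₀ ≤ A j)
    (hMN : M ≤ N) (hN : 0 < N) (hℓ : 0 < ℓ) (hℓ' : ℓ ≤ 1 / 4) :
    HasLiftDerivBounds n (stepPotential φ Λc T D χ A M N ℓ)
      ((3 * G * Real.sqrt (2 * Real.pi ^ 2 * nashRadius * A₀)⁻¹ * ∑ j, nashFieldConst j n) *
        Real.sqrt D * (N : ℝ)⁻¹) (2 * Λf + 20 * N) :=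
  (hasLiftDerivBounds_stepPre hD hTb hT hχ hΛ hφ hΛc hA₀ hA hMN hN).kernel_convolution hℓ hℓ'

/-! ### The tensor `𝒟` in the currency -/

/-- **`𝒟` costs one derivative and a factor `8`**: from `HasLiftDerivBounds (n+1) f C L` (`L ≥ 0`),
every entry of `𝒟f` obeys `HasLiftDerivBounds n (𝒟f)_{ab} (8 C L) L`
(`(𝒟f)_{ab} = -(∂_bf)_a - (∂_af)_b + 2δ_{ab} ∑ᵢ(∂ᵢf)ᵢ`: at most `1 + 1 + 2·3` terms of size `C L`).
[cite: CoiculescuPalasek2025, Def. 3.4] -/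
theorem hasLiftDerivBounds_dTensor_entry {f : UnitAddTorus (Fin 3) → EuclideanSpace ℝ (Fin 3)} {C L : ℝ}
    (hf : HasLiftDerivBounds (n + 1) f C L) (hL : 0 ≤ L) (a b : Fin 3) :
    HasLiftDerivBounds n (fun x => dTensor f x a b) (8 * (C * L)) L := by
  have hC := hf.nonneg
  have hA : HasLiftDerivBounds n (fun x => Torus.partialDeriv b f x a) (C * L) L := (hf.partialDeriv b).apply_coord a
  have hB : HasLiftDerivBounds n (fun x => Torus.partialDeriv a f x b) (C * L) L := (hf.partialDeriv a).apply_coord b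
  have hdiv : HasLiftDerivBounds n (Torus.divergence f) (∑ _i : Fin 3, C * L) L := by
    have h := HasLiftDerivBounds.sum Finset.univ (fun i _ => (hf.partialDeriv i).apply_coord i) hL
    have hdf : Torus.divergence f = fun y => ∑ i, Torus.partialDeriv i f y i :=
      funext fun y => divergence_eq_sum_partialDeriv_apply (hf.isSmooth.isContDiff (by simp)) y
    rw [hdf]
    exact h
  rw [Finset.sum_const, Finset.card_univ, Fintype.card_fin] at hdiv
  simp only [nsmul_eq_mul, Nat.cast_ofNat] at hdiv
  by_cases h : a = b
  · have hfun : (fun x => dTensor f x a b) = fun x =>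
        (-(Torus.partialDeriv b f x a) - Torus.partialDeriv a f x b) + (2 : ℝ) • Torus.divergence f x := by
      funext x; simp [dTensor, h, smul_eq_mul]
    rw [hfun]
    have h1 := (hA.neg.sub hB).add (hdiv.const_smul (2 : ℝ))
    refine h1.mono ?_ hL le_rfl
    rw [abs_of_pos (by norm_num : (0 : ℝ) < 2)]
    nlinarith [mul_nonneg hC hL]
  · have hfun : (fun x => dTensor f x a b) = fun x =>
        -(Torus.partialDeriv b f x a) - Torus.partialDeriv a f x b := by
      funext x; simp [dTensor, h]
    rw [hfun]
    refine (hA.neg.sub hB).mono ?_ hL le_rfl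
    nlinarith [mul_nonneg hC hL]

/-- **`𝒟f` as a tensor field** (sup norm on `Fin 3 → Fin 3 → ℝ`): `HasLiftDerivBounds n (𝒟f) (8CL) L`
from `HasLiftDerivBounds (n+1) f C L`. [cite: CoiculescuPalasek2025, Def. 3.4] -/
theorem hasLiftDerivBounds_dTensor {f : UnitAddTorus (Fin 3) → EuclideanSpace ℝ (Fin 3)} {C L : ℝ}
    (hf : HasLiftDerivBounds (n + 1) f C L) (hL : 0 ≤ L) :
    HasLiftDerivBounds n (dTensor f) (8 * (C * L)) L := by
  have h8 : 0 ≤ 8 * (C * L) := by have := hf.nonneg; positivity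
  refine HasLiftDerivBounds.of_pi (fun a => ?_) h8 hL
  exact HasLiftDerivBounds.of_pi (fun b => hasLiftDerivBounds_dTensor_entry hf hL a b) h8 hL

/-- **The upper bound of Prop. 3.7 for the step** ("`‖𝒟ψ⁰_k‖_∞ ≤ C₂ ‖𝒟ψ⁰_{k-1}‖_∞^{1/2}`", with all
orders): `𝒟g_k` obeys `HasLiftDerivBounds n (𝒟g_k) (8 𝔎_{n+1} √D N⁻¹ (2Λf + 20N)) (2Λf + 20N)`; in
particular `‖𝒟g_k‖_∞ ≤ 8·42·𝔎 √D` when `Λf ≤ 11N`. [cite: CoiculescuPalasek2025, Lemma 3.6 (iterativeboundsII), Prop. 3.7 (upper bound)] -/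
theorem hasLiftDerivBounds_dTensor_stepPre (hD : 0 < D) (hTb : ∀ x, ‖T x‖ ≤ D)
    (hT : HasLiftDerivBounds (n + 1) T (D / nashRadius) Λf) (hχ : HasLiftDerivBounds (n + 1) χ 1 Λf)
    (hΛ : 0 ≤ Λf) (hφ : ∀ j, HasLiftDerivBounds (n + 1) (φ j) G 1) (hΛc : ∀ j, ‖Λc j‖ ≤ 1)
    (hA₀ : 0 < A₀) (hA : ∀ j, A₀ ≤ A j) (hMN : M ≤ N) (hN : 0 < N) :
    HasLiftDerivBounds n (dTensor (stepPre φ Λc T D χ A M N))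
      (8 * (((3 * G * Real.sqrt (2 * Real.pi ^ 2 * nashRadius * A₀)⁻¹ * ∑ j, nashFieldConst j (n + 1)) *
        Real.sqrt D * (N : ℝ)⁻¹) * (2 * Λf + 20 * N))) (2 * Λf + 20 * N) :=
  hasLiftDerivBounds_dTensor (hasLiftDerivBounds_stepPre hD hTb hT hχ hΛ hφ hΛc hA₀ hA hMN hN)
    (by positivity)

/-- **All orders of the new tensor from its sup norm** ("placing derivatives on the mollifier",
proof of Prop. 3.7): if `‖𝒟g_k‖_∞ ≤ D'` then `HasLiftDerivBounds m (k_ℓ ⋆ 𝒟g_k) D' (c̄_m/ℓ)` for EVERY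
`m` — the input of the next step's amplitudes, with constants independent of the level.
[cite: CoiculescuPalasek2025, Prop. 3.7 (proof: "using the mollifier to absorb the derivatives")] -/
theorem hasLiftDerivBounds_stepTensor_of_norm_le {D' : ℝ}
    (hg : IsSmooth (stepPre φ Λc T D χ A M N)) (hD' : ∀ x, ‖dTensor (stepPre φ Λc T D χ A M N) x‖ ≤ D')
    (hℓ : 0 < ℓ) (hℓ' : ℓ ≤ 1 / 4) (m : ℕ) :
    HasLiftDerivBounds m (stepTensor φ Λc T D χ A M N ℓ) D' (derivProfileMassSup (Fin 3) m / ℓ) := by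
  have hs : IsSmooth (dTensor (stepPre φ Λc T D χ A M N)) :=
    contDiff_pi.2 fun a => contDiff_pi.2 fun b => isSmooth_dTensor_entry hg a b
  exact hasLiftDerivBounds_kernel_convolution_of_norm_le hs hD' hℓ hℓ' m

end Bounds

/-! ## The new tensor is `𝒟` of the new potential; symmetry; smoothness -/

section Tensor

variable {φ : Fin 6 → UnitAddTorus (Fin 3) → ℝ} {Λc : Fin 6 → ℂ}
  {T : UnitAddTorus (Fin 3) → (Fin 3 → Fin 3 → ℝ)} {D : ℝ} {χ : UnitAddTorus (Fin 3) → ℝ}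
  {A : Fin 6 → ℝ} {M N : ℕ} {ℓ : ℝ}

/-- Entries of a tensor-valued mollification are mollifications of the entries. [folklore] -/
theorem kernel_convolution_tensor_apply {ℓ : ℝ} (hℓ : 0 < ℓ) (hℓ' : ℓ ≤ 1 / 4)
    {S : UnitAddTorus (Fin 3) → (Fin 3 → Fin 3 → ℝ)} (hS : Continuous S) (x : UnitAddTorus (Fin 3)) (a b : Fin 3) :
    (kernel ℓ ⋆ S) x a b = (kernel ℓ ⋆ fun y => S y a b) x := by
  set ev : (Fin 3 → Fin 3 → ℝ) →L[ℝ] ℝ :=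
    (ContinuousLinearMap.proj (R := ℝ) (φ := fun _ : Fin 3 => ℝ) b).comp
      (ContinuousLinearMap.proj (R := ℝ) (φ := fun _ : Fin 3 => Fin 3 → ℝ) a) with hev
  have h := congrFun (clm_comp_convolution ev (isSmooth_kernel hℓ hℓ').integrable hS) x
  have h1 : (fun y => S y a b) = ev ∘ S := by funext y; simp [hev]
  have h2 : (kernel ℓ ⋆ S) x a b = (ev ∘ (kernel ℓ ⋆ S)) x := by simp [hev]
  rw [h1, h2, h]

/-- Coordinates of a vector-valued mollification are mollifications of the coordinates. [folklore] -/
theorem kernel_convolution_vec_apply {ℓ : ℝ} (hℓ : 0 < ℓ) (hℓ' : ℓ ≤ 1 / 4)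
    {u : UnitAddTorus (Fin 3) → EuclideanSpace ℝ (Fin 3)} (hu : Continuous u) (x : UnitAddTorus (Fin 3)) (i : Fin 3) :
    (kernel ℓ ⋆ u) x i = (kernel ℓ ⋆ fun y => u y i) x := by
  have h := congrFun (clm_comp_convolution (EuclideanSpace.proj i) (isSmooth_kernel hℓ hℓ').integrable hu) x
  have h1 : (fun y => u y i) = (EuclideanSpace.proj i : EuclideanSpace ℝ (Fin 3) →L[ℝ] ℝ) ∘ u := by
    funext y; simp
  have h2 : (kernel ℓ ⋆ u) x i = ((EuclideanSpace.proj i : EuclideanSpace ℝ (Fin 3) →L[ℝ] ℝ) ∘ (kernel ℓ ⋆ u)) x := by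
    simp
  rw [h1, h2, h]

/-- Mollification of a negated real function. [folklore] -/
theorem kernel_convolution_neg' (ℓ : ℝ) (h : UnitAddTorus (Fin 3) → ℝ) : kernel ℓ ⋆ (-h) = -(kernel ℓ ⋆ h) := by
  rw [← neg_one_smul ℝ h, convolution_smul, neg_one_smul]

/-- **`𝒟` commutes with mollification**: `𝒟(k_ℓ ⋆ g) = k_ℓ ⋆ 𝒟g` for smooth `g` (partial derivatives
commute with convolution, `Torus.partialDeriv_convolution`, and everything is linear).
[cite: CoiculescuPalasek2025, Def. 3.5 / Prop. 4.1 (`R_k = φ_k ∗ 𝒟∑_j a_{j,k}Ψ_{j,k}`)] -/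
theorem dTensor_kernel_convolution {g : UnitAddTorus (Fin 3) → EuclideanSpace ℝ (Fin 3)} (hg : IsSmooth g)
    (hℓ : 0 < ℓ) (hℓ' : ℓ ≤ 1 / 4) : dTensor (kernel ℓ ⋆ g) = kernel ℓ ⋆ dTensor g := by
  have hκi := (isSmooth_kernel (d := Fin 3) hℓ hℓ').integrable
  have hsm : IsSmooth (dTensor g) := contDiff_pi.2 fun a => contDiff_pi.2 fun b => isSmooth_dTensor_entry hg a b
  have hsmk : IsSmooth (kernel ℓ ⋆ g) := isSmooth_convolution hκi hg
  -- the coordinate functions of the partial derivatives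
  set P : Fin 3 → Fin 3 → UnitAddTorus (Fin 3) → ℝ := fun i j y => Torus.partialDeriv i g y j with hP
  have hcont : ∀ i j : Fin 3, Continuous (P i j) := fun i j => ((hg.partialDeriv i).apply j).continuous
  have eP : ∀ i j : Fin 3, ∀ x, ConvolutionExistsAt (kernel ℓ) (P i j) x (ContinuousLinearMap.lsmul ℝ ℝ) volume :=
    fun i j x => convolutionExistsAt_of_continuous _ hκi (hcont i j) x
  have eN : ∀ i j : Fin 3, ∀ x, ConvolutionExistsAt (kernel ℓ) (-P i j) x (ContinuousLinearMap.lsmul ℝ ℝ) volume :=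
    fun i j x => convolutionExistsAt_of_continuous _ hκi (hcont i j).neg x
  -- partial derivatives and the divergence of the mollification
  have hpd : ∀ i j : Fin 3, ∀ x, Torus.partialDeriv i (kernel ℓ ⋆ g) x j = (kernel ℓ ⋆ P i j) x := by
    intro i j x
    rw [partialDeriv_convolution hκi (hg.isContDiff (by simp)) i,
      kernel_convolution_vec_apply hℓ hℓ' (hg.partialDeriv i).continuous x j]
  have hdiv : ∀ x, Torus.divergence (kernel ℓ ⋆ g) x = (kernel ℓ ⋆ Torus.divergence g) x := by
    intro x
    rw [divergence_eq_sum_partialDeriv_apply (hsmk.isContDiff (by simp))]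
    have hd : Torus.divergence g = fun y => ∑ i, P i i y :=
      funext fun y => divergence_eq_sum_partialDeriv_apply (hg.isContDiff (by simp)) y
    rw [hd, convolution_finset_sum_right hκi _ (fun i _ => hcont i i)]
    exact Finset.sum_congr rfl fun i _ => hpd i i x
  have eD : ∀ x, ConvolutionExistsAt (kernel ℓ) ((2 : ℝ) • Torus.divergence g) x (ContinuousLinearMap.lsmul ℝ ℝ) volume :=
    fun x => convolutionExistsAt_of_continuous _ hκi (hg.divergence.continuous.const_smul _) x
  funext x a b
  rw [kernel_convolution_tensor_apply hℓ hℓ' hsm.continuous x a b]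
  by_cases h : a = b
  · subst h
    have hF : (fun y => dTensor g y a a) = (-P a a + -P a a) + (2 : ℝ) • Torus.divergence g := by
      funext y; simp [dTensor_apply, hP, smul_eq_mul]; ring
    have eNN : ConvolutionExistsAt (kernel ℓ) (-P a a + -P a a) x (ContinuousLinearMap.lsmul ℝ ℝ) volume :=
      convolutionExistsAt_of_continuous _ hκi ((hcont a a).neg.add (hcont a a).neg) x
    rw [hF, eNN.distrib_add (eD x), (eN a a x).distrib_add (eN a a x),
      kernel_convolution_neg', convolution_smul]
    simp only [Pi.neg_apply, Pi.smul_apply, smul_eq_mul, dTensor_apply, if_true, hpd, hdiv]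
    ring
  · have hF : (fun y => dTensor g y a b) = -P b a + -P a b := by
      funext y; simp [dTensor_apply, hP, h]; ring
    rw [hF, (eN b a x).distrib_add (eN a b x), kernel_convolution_neg', kernel_convolution_neg']
    simp only [Pi.neg_apply, dTensor_apply, if_neg h, hpd, mul_zero, add_zero]
    ring

/-- **The new tensor is `𝒟` of the new potential**: `k_ℓ ⋆ 𝒟g_k = 𝒟(k_ℓ ⋆ g_k) = 𝒟ψ⁰_k`.
[cite: CoiculescuPalasek2025, Def. 3.5] -/
theorem stepTensor_eq_dTensor_stepPotential (hg : IsSmooth (stepPre φ Λc T D χ A M N))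
    (hℓ : 0 < ℓ) (hℓ' : ℓ ≤ 1 / 4) :
    stepTensor φ Λc T D χ A M N ℓ = dTensor (stepPotential φ Λc T D χ A M N ℓ) := by
  rw [stepTensor, stepPotential, dTensor_kernel_convolution hg hℓ hℓ']

/-- The new tensor is symmetric. [cite: CoiculescuPalasek2025, Def. 3.4] -/
theorem stepTensor_symm (hg : IsSmooth (stepPre φ Λc T D χ A M N)) (hℓ : 0 < ℓ) (hℓ' : ℓ ≤ 1 / 4)
    (x : UnitAddTorus (Fin 3)) (a b : Fin 3) :
    stepTensor φ Λc T D χ A M N ℓ x a b = stepTensor φ Λc T D χ A M N ℓ x b a := by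
  rw [stepTensor_eq_dTensor_stepPotential hg hℓ hℓ']
  exact dTensor_symm _ x a b

end Tensor

end CP25

end Literature.Analysis.FluidPDE
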